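import Literature.Probability.Divergences.KLDivConvexity
import Literature.Probability.Entropy.StrongDataProcessingProofs
import Mathlib.InformationTheory.KullbackLeibler.ChainRule
import Mathlib.MeasureTheory.Measure.Prod
import HarnessLib

/-!
# The entropy–event bound of the relative-entropy method, and `KL(Q⊗Q ‖ P⊗P) = 2 KL(Q‖P)`

Topic `Literature/Probability/Divergences`; sequel of `KLDivConvexity.lean` (the log-form
Gibbs / Donsker–Varadhan inequality `integral_le_toReal_klDiv_add_log`).

* `toReal_mul_log_le_of_klDiv_ne_top` — **the entropy inequality for events** (Kipnis–Landim,
  Appendix 1, Prop. 8.2): for probability measures `Q, P` and a measurable `A` with `P(A) > 0`,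
  `Q(A) · log(1 + 1/P(A)) ≤ log 2 + KL(Q‖P)` (test function `log(1 + 1/P(A)) · 1_A` in the log-form
  inequality, `∫ e^ψ dP = 2`). This is the one inequality of Yau's relative-entropy method that turns
  "`A` is exponentially rare under `P`" plus "`Q` has sub-exponential entropy w.r.t. `P`" into
  "`A` is rare under `Q`":
* `toReal_measure_le_of_klDiv_le` — if `P(A) ≤ e^{-G}` and `KL(Q‖P) ≤ H` then
  `Q(A) ≤ (log 2 + H)/G`;
* `klDiv_prod_self_eq_add` — **tensorisation over two independent copies**,
  `KL(Q ⊗ Q ‖ P ⊗ P) = KL(Q‖P) + KL(Q‖P)` (Mathlib's chain rule `klDiv_compProd_eq_add` with constant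
  kernels, swapping the factors through the invariance of `klDiv` under a measurable embedding,
  `Literature.Probability.Entropy.klDiv_map_of_measurableEmbedding` of `StrongDataProcessingProofs.lean`).

General product measures `KL(⊗ᵢ Qᵢ ‖ ⊗ᵢ Pᵢ) = ∑ KL(Qᵢ‖Pᵢ)` and the `n`-fold power are not treated.
-/

noncomputable section

open _root_.MeasureTheory _root_.InformationTheory _root_.ProbabilityTheory Set
open scoped ENNReal

namespace Literature.Probability.Divergences

variable {α : Type*} [MeasurableSpace α]

/-- **Entropy inequality for events** (relative-entropy method): for probability measures `Q, P`,
a measurable set `A` with `P(A) ≠ 0` and `KL(Q‖P) < ∞`,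
`Q(A) · log(1 + 1/P(A)) ≤ log 2 + KL(Q‖P)`.
[cite: KipnisLandim1999, Appendix 1 Prop. 8.2 (p. 338)] -/
theorem toReal_mul_log_le_of_klDiv_ne_top (Q P : Measure α) [IsProbabilityMeasure Q]
    [IsProbabilityMeasure P] {A : Set α} (hA : MeasurableSet A) (hPA : P A ≠ 0)
    (hfin : klDiv Q P ≠ ⊤) :
    (Q A).toReal * Real.log (1 + (P A).toReal⁻¹) ≤ Real.log 2 + (klDiv Q P).toReal := by
  set p : ℝ := (P A).toReal with hpdef
  have hp0 : 0 < p := ENNReal.toReal_pos hPA (measure_ne_top P A)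
  have hp1 : 0 < 1 + p⁻¹ := by positivity
  set c : ℝ := Real.log (1 + p⁻¹) with hcdef
  have hc0 : 0 ≤ c := Real.log_nonneg (by linarith [inv_pos.2 hp0])
  set ψ : α → ℝ := A.indicator (fun _ => c) with hψdef
  have hψm : Measurable ψ := measurable_const.indicator hA
  have hψb : ∀ x, |ψ x| ≤ c := by
    intro x
    by_cases hx : x ∈ A
    · simp only [hψdef, Set.indicator_of_mem hx, abs_of_nonneg hc0, le_refl]
    · simp only [hψdef, Set.indicator_of_notMem hx, abs_zero, hc0]
  have h := integral_le_toReal_klDiv_add_log hfin hψm hψb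
  have h1 : ∫ x, ψ x ∂Q = (Q A).toReal * c := by
    rw [hψdef, integral_indicator_const c hA, smul_eq_mul, measureReal_def]
  have hexp : ∀ x, Real.exp (ψ x) = A.indicator (fun _ => p⁻¹) x + 1 := by
    intro x
    by_cases hx : x ∈ A
    · simp only [hψdef, Set.indicator_of_mem hx, hcdef, Real.exp_log hp1]
      ring
    · simp only [hψdef, Set.indicator_of_notMem hx, Real.exp_zero, zero_add]
  have h2 : ∫ x, Real.exp (ψ x) ∂P = 2 := by
    simp_rw [hexp]
    rw [integral_add ((integrable_const _).indicator hA) (integrable_const _),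
      integral_indicator_const _ hA, integral_const, smul_eq_mul, smul_eq_mul, probReal_univ,
      measureReal_def, ← hpdef, mul_inv_cancel₀ hp0.ne']
    norm_num
  rw [h1, h2] at h
  linarith

/-- **The lever of the relative-entropy method**: if `P(A) ≤ e^{-G}` with `G > 0` and
`KL(Q‖P) ≤ H`, then `Q(A) ≤ (log 2 + H)/G` (for `P(A) = 0`, absolute continuity from `KL < ∞` gives
`Q(A) = 0`). [cite: KipnisLandim1999, Appendix 1 Prop. 8.2 (p. 338)] -/
theorem toReal_measure_le_of_klDiv_le (Q P : Measure α) [IsProbabilityMeasure Q]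
    [IsProbabilityMeasure P] {A : Set α} (hA : MeasurableSet A) {G H : ℝ} (hG : 0 < G)
    (hH : 0 ≤ H) (hP : P A ≤ ENNReal.ofReal (Real.exp (-G))) (hKL : klDiv Q P ≤ ENNReal.ofReal H) :
    (Q A).toReal ≤ (Real.log 2 + H) / G := by
  have hfin : klDiv Q P ≠ ⊤ := ne_top_of_le_ne_top ENNReal.ofReal_ne_top hKL
  have hRHS : 0 ≤ (Real.log 2 + H) / G := by positivity
  by_cases hPA : P A = 0
  · have hac : Q ≪ P := (klDiv_ne_top_iff.1 hfin).1
    rw [hac hPA, ENNReal.toReal_zero]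
    exact hRHS
  · have h := toReal_mul_log_le_of_klDiv_ne_top Q P hA hPA hfin
    have hp : (P A).toReal ≤ Real.exp (-G) :=
      ENNReal.toReal_le_of_le_ofReal (Real.exp_pos _).le hP
    have hp0 : 0 < (P A).toReal := ENNReal.toReal_pos hPA (measure_ne_top P A)
    have hlog : G ≤ Real.log (1 + (P A).toReal⁻¹) := by
      have h1 : Real.exp G ≤ (P A).toReal⁻¹ := by
        rw [Real.exp_neg] at hp
        exact (le_inv_comm₀ hp0 (Real.exp_pos G)).1 hp
      calc G = Real.log (Real.exp G) := (Real.log_exp G).symm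
        _ ≤ Real.log (1 + (P A).toReal⁻¹) :=
          Real.log_le_log (Real.exp_pos G) (h1.trans (by linarith))
    have hQ0 : 0 ≤ (Q A).toReal := ENNReal.toReal_nonneg
    rw [le_div_iff₀ hG]
    calc (Q A).toReal * G ≤ (Q A).toReal * Real.log (1 + (P A).toReal⁻¹) :=
          mul_le_mul_of_nonneg_left hlog hQ0
      _ ≤ Real.log 2 + (klDiv Q P).toReal := h
      _ ≤ Real.log 2 + H := by linarith [ENNReal.toReal_le_of_le_ofReal hH hKL]

/-- **Tensorisation over two independent copies**: `KL(Q ⊗ Q ‖ P ⊗ P) = KL(Q‖P) + KL(Q‖P)`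
(chain rule with constant kernels; the second summand `KL(Q⊗Q ‖ Q⊗P)` is identified with
`KL(Q‖P)` by swapping the factors and the chain rule with equal kernels).
[folklore] -/
theorem klDiv_prod_self_eq_add (Q P : Measure α) [IsProbabilityMeasure Q]
    [IsProbabilityMeasure P] : klDiv (Q.prod Q) (P.prod P) = klDiv Q P + klDiv Q P := by
  have hsw : MeasurableEmbedding (Prod.swap : α × α → α × α) :=
    (MeasurableEquiv.prodComm : α × α ≃ᵐ α × α).measurableEmbedding
  have h1 : klDiv (Q.prod Q) (P.prod P) =
      klDiv Q P + klDiv (Q ⊗ₘ Kernel.const α Q) (Q ⊗ₘ Kernel.const α P) := by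
    rw [← Measure.compProd_const, ← Measure.compProd_const, klDiv_compProd_eq_add]
  have h2 : klDiv (Q ⊗ₘ Kernel.const α Q) (Q ⊗ₘ Kernel.const α P) = klDiv Q P := by
    rw [Measure.compProd_const, Measure.compProd_const]
    calc klDiv (Q.prod Q) (Q.prod P)
        = klDiv ((Q.prod Q).map Prod.swap) ((P.prod Q).map Prod.swap) := by
          rw [Measure.prod_swap, Measure.prod_swap]
      _ = klDiv (Q.prod Q) (P.prod Q) :=
          Literature.Probability.Entropy.klDiv_map_of_measurableEmbedding hsw _ _
      _ = klDiv (Q ⊗ₘ Kernel.const α Q) (P ⊗ₘ Kernel.const α Q) := by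
          rw [← Measure.compProd_const, ← Measure.compProd_const]
      _ = klDiv Q P := klDiv_compProd_left Q P _
  rw [h1, h2]

/-- Two independent copies at most double the budget: `KL(Q ⊗ Q ‖ P ⊗ P) ≤ 2 KL(Q‖P)` (with
equality). [folklore] -/
theorem klDiv_prod_self_le (Q P : Measure α) [IsProbabilityMeasure Q] [IsProbabilityMeasure P] :
    klDiv (Q.prod Q) (P.prod P) ≤ 2 * klDiv Q P := by
  rw [klDiv_prod_self_eq_add, two_mul]

end Literature.Probability.Divergences

end
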